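import Summits.QuantumFields.BalabanUV.Beta.FP.HorizontalBookkeepingCov
import Summits.QuantumFields.BalabanUV.Beta.FP.TruncatedFirstMoment

/-!
# `BalabanUV.Beta.FP.HorizontalTailAssemblyCov` — road «FP» for binder row D1, organisation γ, RULING R-FP-32 (repair (R2) of FINDING F-d1leaf01g10-1):
# THE (a)-SOCKET OF THE γ-END WITHOUT THE EVENNESS LETTER — `HasSum (Xtr·v_μ·v_ν) (g N + N⁶·(t0Defect + t1Defect))` for ANY kernel `K` (no hypothesis on `K`
# at all), and the size of the new defect at the truncation of a (5.7)-COVARIANT kernel with sextic decay: `N⁶·|t1Defect| ≤ 64·(80C)·(c·e^δ∕δ)`, N-FREE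

HONEST DEPENDENCY (page 1, mandatory): continuum YM on T⁴ ⇐ BetaPertH ∧ nine spine estimates (0/9 proved); BetaPertH ⇐ (D1) ∧ (D4) ∧
CAP+tail; G-an2-4 gates asym, D1 and NE2/3/4.  HONEST FRAMING (cell contract, verbatim): «discharging `BetaPertH` makes Bałaban's UV
stability UNCONDITIONAL — a real constructive-QFT result; it is NOT the continuum limit and NOT the Clay problem.»  THIS MODULE is [folklore]
composition BY NAME of: `HorizontalBookkeepingCov.hasSum_coarse_secondMoment_truncK_t0t1` ∕ `pow_six_mul_abs_t1Defect_le_of_expL1'` (this seat, (C-up)),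
`HorizontalTailAssembly.sum_box_window_eq` (leaf-05-g8), `TruncatedFirstMoment.abs_firstMoment_truncK_le_of_cov_flip'` (this seat, (B): the letter `A₁ = 80C` from
`AxisReflectionCovariant (flipK K)` + (K6)), and — for the (T0) half, unchanged — `TruncatedZerothMoment.abs_tsum_truncK_le_of_hasSum_zero` (leaf-05-g8, `A = 40C`) with
`HorizontalBookkeepingDefectAveraged.pow_six_mul_abs_t0Defect_le_of_expL1` (leaf-02).  No `def`, no `def … : Prop`, nothing cited, 0 sorry; 0 estimates of Bałaban's
objects; 0∕4 row-D1 binders; NOT hbook, NOT hasym, NOT D1, NOT BetaPertH, NOT continuum, NOT Clay.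

ABSOLUTE RULE (cell charter, verbatim): «No internally-minted statement may enter as a cited fact. Every hypothesis is either kernel-proved in this
package or a verbatim quotation of a PUBLISHED theorem with page reference. The manuscript(s) under audit are NOT citable for their own disputed
steps — they are the thing under adjudication; programme-internal (2001/route/tribunal) claims are never citable.»

WHY (R-FP-32).  `HorizontalTailAssembly.hasSum_truncatedTransport` — the (a)-socket consumed by `HorizontalRemainderPerfect.hasSum_truncatedTransport_of_expL1` and every
γ∕H-route END above it — carries `heven : ∀ c e t, K c e (−t) = K c e t`, unfillable off the diagonal by a reflection-covariant kernel (`EvenKernelNoGo`).  Here the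
socket is re-cut with NO parity hypothesis: the four `m₁`-terms of the nine-term identity are kept as `t1Defect` (exact), and bounded — for `T = truncK K N` with
`AxisReflectionCovariant (flipK K)` + (K6) — by `64·(80C)·(c·e^δ∕δ)∕N ≤ 64·(80C)·(c·e^δ∕δ)` in the exp-ℓ¹ transport currency of the owner's END.  The owner's downstream
twins (`HorizontalRemainderPerfectCov.hasSum_truncatedTransport_of_expL1_cov`, `…_cov` ENDs, `RemainderLedgerCov`) read §1 + §2 BY NAME with `heven ↦ hcov`.

CONTENT.
* §1 **`hasSum_truncatedTransport_t0t1`** — for ANY `K : EKer 4` and admissible transport `w` ((L0∞) Kronecker masses, (L1∞) constants `Cw`, `AbsMoment₂`), `N ≥ 1`: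
  `HasSum (v ↦ (N⁸·dressedEntry w (truncK K N) (N•v) μ ν)·v_μ·v_ν) (Σ_{0<‖z‖∞≤N} K μ ν z·z_μ·z_ν + N⁶·(t0Defect … + t1Defect …))`.
* §2 **`pow_six_mul_abs_t1Defect_truncK_le_of_cov_expL1`** (`N⁶·|t1Defect N w (truncK K N) Cw κ λ a b| ≤ 64·(80C)·(c·e^δ∕δ)` from `hK` (K6), `hcov`, (L1∞), exp-ℓ¹ mass `c∕N`),
  **`abs_defects_le_of_cov_expL1`** (both defects: `|N⁶·(t0Defect + t1Defect)| ≤ U₀ᴱ + U₁ᴱ` with the owner's `U₀ᴱ = 16·(40C)·(2·(2ce^δ∕δ²) + 2·(ce^δ∕δ)²)` — needs the Ward ∕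
  (T0) letter `HasSum (K c e) 0` exactly as before — and the NEW `U₁ᴱ := 64·(80C)·(c·e^δ∕δ)`), and the packaged (a)-socket **`hasSum_truncatedTransport_cov`**:
  `HasSum (Xtr·v_μ·v_ν) (g N + E₀) ∧ |E₀| ≤ U₀ᴱ + U₁ᴱ` under `hK`, `hcov : AxisReflectionCovariant (flipK K)`, `hK0` and the exp-ℓ¹ transport letters — the signature of
  `HorizontalRemainderPerfect.hasSum_truncatedTransport_of_expL1` with `heven ↦ hcov` and `E₀ ↦ N⁶·(t0Defect + t1Defect)`.
Unit `b2b-balaban-beta-d1-formalise-leaf-01` (gen 10), assignment (C-up) of R-FP-32.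
-/

noncomputable section

namespace Summit.QuantumFields.BalabanUV.Beta.FP.HorizontalTailAssemblyCov

open Finset Filter Topology
open Literature.Probability.LatticeModels (box annulus)
open Literature.MathematicalPhysics.QuantumFieldTheory.Balaban1983to89
open Literature.MathematicalPhysics.QuantumFieldTheory.Balaban1983to89.Beta
open B12Sec2to5 (l1)
open DyadicShell (Pt supNorm mem_box_iff)
open PolarizationSign (AxisReflectionCovariant)
open OneStepKernelFamily (flipK)
open DecimatedMomentSummable (ConstReproSum LinReproSum AbsMoment₂)
open DressedMomentNormalisation (EKer dressedEntry)
open Summit.QuantumFields.BalabanUV.Beta.FP.HorizontalBookkeeping (truncK truncK_apply t0Defect)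
open Summit.QuantumFields.BalabanUV.Beta.FP.HorizontalBookkeepingCov (t1Defect hasSum_coarse_secondMoment_truncK_t0t1 pow_six_mul_abs_t1Defect_le_of_expL1')
open Summit.QuantumFields.BalabanUV.Beta.FP.HorizontalBookkeepingTail (nonneg_of_decay)
open Summit.QuantumFields.BalabanUV.Beta.FP.HorizontalBookkeepingDefectAveraged (absMoment₂_of_expL1 pow_six_mul_abs_t0Defect_le_of_expL1)
open Summit.QuantumFields.BalabanUV.Beta.FP.HorizontalTailAssembly (sum_box_window_eq)
open Summit.QuantumFields.BalabanUV.Beta.FP.TruncatedZerothMoment (abs_tsum_truncK_le_of_hasSum_zero)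
open Summit.QuantumFields.BalabanUV.Beta.FP.TruncatedFirstMoment (abs_firstMoment_truncK_le_of_cov_flip')

/-! ## §1 The (a)-socket with both defects displayed — no hypothesis on `K` -/

/-- [folklore] **THE TRUNCATED TRANSPORT's TOTAL COARSE SECOND MOMENT, (T0)- AND (T1)-DEFECTS DISPLAYED, FOR ANY KERNEL `K`**: for an admissible transport
`w` (Kronecker masses, (L1∞) with constants `Cw`, absolutely summable second moments), `Xtr v := N⁸·dressedEntry w (truncK K N) (N•v) μ ν` has
`HasSum (Xtr·v_μ·v_ν) (g N + N⁶·(t0Defect + t1Defect))`, `g N = Σ_{0<‖z‖∞≤N} K μ ν z·z_μ·z_ν`.  The twin of `HorizontalTailAssembly.hasSum_truncatedTransport`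
WITHOUT `heven` (the truncated kernel has finite support; nothing about `K` is used). -/
theorem hasSum_truncatedTransport_t0t1 {N : ℕ} (hN : 1 ≤ N) (w : EKer 4) (K : EKer 4) (Cw : Fin 4 → Fin 4 → Fin 4 → ℝ)
    (hw0 : ∀ κ l, ConstReproSum N (w κ l) (if κ = l then (((N : ℝ) ^ (4 + 1))⁻¹) else 0))
    (hw1 : ∀ κ l, LinReproSum N (w κ l) (Cw κ l)) (hwA : ∀ κ l, AbsMoment₂ (w κ l)) (μ ν : Fin 4) :
    HasSum (fun v : Pt => ((N : ℝ) ^ 8 * dressedEntry w (truncK K N) ((N : ℤ) • v) μ ν) * (v μ : ℝ) * (v ν : ℝ))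
      ((∑ z ∈ annulus 4 0 N, K μ ν z * (z μ : ℝ) * (z ν : ℝ))
        + (N : ℝ) ^ 6 * (t0Defect N w (truncK K N) Cw μ ν μ ν + t1Defect N w (truncK K N) Cw μ ν μ ν)) := by
  have h := hasSum_coarse_secondMoment_truncK_t0t1 (Nat.lt_of_lt_of_le Nat.zero_lt_one hN) w K N Cw hw0 hw1 hwA μ ν μ ν
  have hval : ∑ t ∈ box 4 N, (t μ * t ν) • truncK K N μ ν t = ∑ z ∈ annulus 4 0 N, K μ ν z * (z μ : ℝ) * (z ν : ℝ) := by
    rw [← sum_box_window_eq (K := K) (μ := μ) (ν := ν) N]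
    refine Finset.sum_congr rfl fun t ht => ?_
    have htN : supNorm t ≤ N := mem_box_iff.mp ht
    rw [truncK_apply, if_pos htN, zsmul_eq_mul]
    push_cast; ring
  rw [hval] at h
  refine h.congr_fun fun v => ?_
  push_cast; ring

/-! ## §2 The defect at the truncation of a (5.7)-covariant kernel, exp-ℓ¹ transport currency -/

/-- [folklore] **THE (T1)-DEFECT OF THE TRUNCATED TRANSPORT IS N-FREE BOUNDED**: (K6) `|K c e t| ≤ C∕(‖t‖∞+1)⁶`, the printed reflection covariance in the kernel
convention `AxisReflectionCovariant (flipK K)`, (L1∞) constants `Cw`, and the exp-weighted ℓ¹ transport mass `Σ'_x e^{(δ/N)|x|₁}|w κ l x| ≤ c∕N` (`δ > 0`, `N ≥ 1`) give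
`N⁶·|t1Defect N w (truncK K N) Cw κ λ a b| ≤ 64·(80·C)·(c·e^δ∕δ)` — `HorizontalBookkeepingCov.pow_six_mul_abs_t1Defect_le_of_expL1'` at the letter
`A₁ = 80·C` of `TruncatedFirstMoment.abs_firstMoment_truncK_le_of_cov_flip'`.  No Ward letter is used. -/
theorem pow_six_mul_abs_t1Defect_truncK_le_of_cov_expL1 {K w : EKer 4} {C c δ : ℝ} {N : ℕ} (hN : 1 ≤ N) (hδ : 0 < δ)
    (hK : ∀ c' e (t : Pt), |K c' e t| ≤ C / ((supNorm t : ℝ) + 1) ^ 6)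
    (hcov : AxisReflectionCovariant (flipK K))
    (Cw : Fin 4 → Fin 4 → Fin 4 → ℝ) (hw1 : ∀ κ l, LinReproSum N (w κ l) (Cw κ l))
    (hwE : ∀ κ l, Summable fun x => Real.exp (δ / N * l1 x) * |w κ l x|)
    (hwEb : ∀ κ l, ∑' x, Real.exp (δ / N * l1 x) * |w κ l x| ≤ c / N) (κ lam a b : Fin 4) :
    (N : ℝ) ^ 6 * |t1Defect N w (truncK K N) Cw κ lam a b| ≤ 64 * (80 * C) * (c * Real.exp δ / δ) :=
  pow_six_mul_abs_t1Defect_le_of_expL1' hN hδ hw1 hwE hwEb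
    (fun c' e μ' => abs_firstMoment_truncK_le_of_cov_flip' hK hcov hN c' e μ') κ lam a b

/-- [folklore] **BOTH DEFECTS OF THE TRUNCATED TRANSPORT, N-FREE**: adding the Ward ∕ (T0) letter `HasSum (K c e) 0` for the (T0) half (unchanged:
`TruncatedZerothMoment` + `HorizontalBookkeepingDefectAveraged`), `|N⁶·(t0Defect + t1Defect)| ≤ U₀ᴱ + U₁ᴱ` with `U₀ᴱ = 16·(40C)·(2·(2ce^δ∕δ²) + 2·(ce^δ∕δ)²)` and
`U₁ᴱ = 64·(80C)·(c·e^δ∕δ)`. -/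
theorem abs_defects_le_of_cov_expL1 {K w : EKer 4} {C c δ : ℝ} {N : ℕ} (hN : 1 ≤ N) (hδ : 0 < δ)
    (hK : ∀ c' e (t : Pt), |K c' e t| ≤ C / ((supNorm t : ℝ) + 1) ^ 6)
    (hcov : AxisReflectionCovariant (flipK K)) (hK0 : ∀ c' e, HasSum (K c' e) 0)
    (Cw : Fin 4 → Fin 4 → Fin 4 → ℝ) (hw1 : ∀ κ l, LinReproSum N (w κ l) (Cw κ l))
    (hwE : ∀ κ l, Summable fun x => Real.exp (δ / N * l1 x) * |w κ l x|)
    (hwEb : ∀ κ l, ∑' x, Real.exp (δ / N * l1 x) * |w κ l x| ≤ c / N) (κ lam a b : Fin 4) :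
    |(N : ℝ) ^ 6 * (t0Defect N w (truncK K N) Cw κ lam a b + t1Defect N w (truncK K N) Cw κ lam a b)|
      ≤ 16 * (40 * C) * (2 * (2 * c * Real.exp δ / δ ^ 2) + 2 * (c * Real.exp δ / δ) * (c * Real.exp δ / δ))
        + 64 * (80 * C) * (c * Real.exp δ / δ) := by
  have hC : 0 ≤ C := nonneg_of_decay hK κ lam
  have hA : ∀ c' e, |∑' t : Pt, truncK K N c' e t| ≤ 40 * C / (N : ℝ) ^ 2 :=
    fun c' e => abs_tsum_truncK_le_of_hasSum_zero hC c' e (hK c' e) (hK0 c' e) hN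
  have h0 := pow_six_mul_abs_t0Defect_le_of_expL1 hN hδ hw1 hwE hwEb hA κ lam a b
  have h1 := pow_six_mul_abs_t1Defect_truncK_le_of_cov_expL1 hN hδ hK hcov Cw hw1 hwE hwEb κ lam a b
  rw [mul_add]
  refine (abs_add_le _ _).trans (add_le_add ?_ ?_)
  · rwa [abs_mul, abs_of_nonneg (by positivity : (0 : ℝ) ≤ (N : ℝ) ^ 6)]
  · rwa [abs_mul, abs_of_nonneg (by positivity : (0 : ℝ) ≤ (N : ℝ) ^ 6)]

/-- **THE (a)-SOCKET OF THE γ-END, RE-CUT ON (5.7)-COVARIANCE (R-FP-32)** [folklore]: Kronecker coset sums (L0∞), (L1∞) constants `Cw`, the exp-weighted ℓ¹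
transport mass `Σ'_x e^{(δ/N)|x|₁}|w κ l x| ≤ c∕N`, and three kernel letters — sextic decay (K6), the PRINTED REFLECTION COVARIANCE `AxisReflectionCovariant (flipK K)`
(in place of the unfillable evenness), the Ward ∕ (T0) letter `HasSum (K c e) 0` — give the truncated transport's TOTAL coarse second moment
`HasSum (Xtr·v_μ·v_ν) (g N + E₀)` with `E₀ = N⁶·(t0Defect + t1Defect)` and the DISPLAYED N-free bound `|E₀| ≤ U₀ᴱ + U₁ᴱ`.  This is the signature of
`HorizontalRemainderPerfect.hasSum_truncatedTransport_of_expL1` with `heven ↦ hcov`; the owner's `…Cov` ENDs read it BY NAME. -/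
theorem hasSum_truncatedTransport_cov {K w : EKer 4} {C c δ : ℝ} {N : ℕ} (hN : 1 ≤ N) (hδ : 0 < δ)
    (hK : ∀ c' e (t : Pt), |K c' e t| ≤ C / ((supNorm t : ℝ) + 1) ^ 6)
    (hcov : AxisReflectionCovariant (flipK K))
    (hK0 : ∀ c' e, HasSum (K c' e) 0)
    (Cw : Fin 4 → Fin 4 → Fin 4 → ℝ)
    (hw0 : ∀ κ l, ConstReproSum N (w κ l) (if κ = l then (((N : ℝ) ^ (4 + 1))⁻¹) else 0))
    (hw1 : ∀ κ l, LinReproSum N (w κ l) (Cw κ l))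
    (hwE : ∀ κ l, Summable fun x => Real.exp (δ / N * l1 x) * |w κ l x|)
    (hwEb : ∀ κ l, ∑' x, Real.exp (δ / N * l1 x) * |w κ l x| ≤ c / N) (μ ν : Fin 4) :
    HasSum (fun v : Pt => ((N : ℝ) ^ 8 * dressedEntry w (truncK K N) ((N : ℤ) • v) μ ν) * (v μ : ℝ) * (v ν : ℝ))
        ((∑ z ∈ annulus 4 0 N, K μ ν z * (z μ : ℝ) * (z ν : ℝ))
          + (N : ℝ) ^ 6 * (t0Defect N w (truncK K N) Cw μ ν μ ν + t1Defect N w (truncK K N) Cw μ ν μ ν))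
      ∧ |(N : ℝ) ^ 6 * (t0Defect N w (truncK K N) Cw μ ν μ ν + t1Defect N w (truncK K N) Cw μ ν μ ν)|
          ≤ 16 * (40 * C) * (2 * (2 * c * Real.exp δ / δ ^ 2) + 2 * (c * Real.exp δ / δ) * (c * Real.exp δ / δ))
            + 64 * (80 * C) * (c * Real.exp δ / δ) := by
  have hwA : ∀ κ l, AbsMoment₂ (w κ l) := fun κ l => absMoment₂_of_expL1 hδ hN (hwE κ l) (hwEb κ l)
  exact ⟨hasSum_truncatedTransport_t0t1 hN w K Cw hw0 hw1 hwA μ ν,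
    abs_defects_le_of_cov_expL1 hN hδ hK hcov hK0 Cw hw1 hwE hwEb μ ν μ ν⟩

end Summit.QuantumFields.BalabanUV.Beta.FP.HorizontalTailAssemblyCov

end
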